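import Literature.AlgebraicGeometry.HodgeTheory.HodgeFrameOfRelativeForms
import HarnessLib

/-!
# A holomorphic frame of `Fⁿ 𝓗ⁿ` from relative closed forms — read in the ALGEBRAIC chart of the base
# (Griffiths 1968 Thm. 1.1 / Voisin I Thm. 10.3 for `p = n`; chart-pinned form of `HodgeFrameOfRelativeForms`)

Family `hodge`, layer `Literature/AlgebraicGeometry/HodgeTheory`; proof file (theorems only, no
definition, no named fact). Written by the prover seat `hodge-nonav-prover-Ax` (g13, cell `hodge-nonav`),
programme «AE» (route `HodgeConjecture/CyclicUnitaryPowers`, `--supports stmt-HodgeConjecture-19544`).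

`HodgeFrameOfRelativeForms.exists_weightFrames_of_relativeForms` (prover-Bx, brick FF4a of programme B4)
produces, near a point `t₁` of the base of a smooth projective family, a frame of the top Hodge bundle
`Fⁿ𝓗ⁿ` in flat coordinates whose coordinates are holomorphic on `ψ(W₀)` for SOME chart `ψ` of `S(ℂ)`,
existentially quantified. Its proof takes `ψ` to be the algebraic chart `extChartAt 𝓘(ℂ, ℂᵐ) t₁` of the
atlas `algebraicChart S m` (Serre, GAGA §2), transferred to the `univ`-subtype. Consumers who want to
compare the Hodge loci — zero sets of holomorphic functions of these coordinates (Voisin II Lemma 5.13;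
the tree's `hodgeLoci_subset_zeroSet_of_holomorphicFrame`) — with OTHER holomorphic functions on the
base (regular functions, e.g. the coefficients of the defining form, holomorphic in algebraic charts by
GAGA) need to know WHICH chart: this file re-runs the same proof and records it.

* `exists_weightFrames_of_relativeForms_chartAt` — verbatim the statement of
  `exists_weightFrames_of_relativeForms`, plus: `ψ t = extChartAt 𝓘(ℂ, ℂᵐ) t₁ t`,
  `t ∈ ψ.source ↔ t ∈ (extChartAt … t₁).source`, `ψ.symm z = (extChartAt … t₁).symm z` (all `rfl` for the
  construction). The measure-theoretic sharpening of «very general» for the Carlson–Toledo family (the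
  non-Hodge-generic coefficient vectors are Lebesgue-null) rests on this.

## References

* [Griffiths1968PeriodsII] P. Griffiths, Periods of integrals on algebraic manifolds II, Amer. J. Math.
  90 (1968), Thm. 1.1.
* [VoisinHodgeI2002] C. Voisin, Hodge Theory and Complex Algebraic Geometry I (2002), §9.2.1, §9.3,
  §10.2.1 Thm. 10.3.
* [VoisinHodgeII2003] C. Voisin, Hodge Theory and Complex Algebraic Geometry II (2003), §5.3.1 Lemma 5.13.
* [SerreGAGA1956] J.-P. Serre, Géométrie algébrique et géométrie analytique, §2 n°5.
* [Griffiths1969] P. Griffiths, On the periods of certain rational integrals I, Ann. of Math. 90 (1969), §8.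
-/

noncomputable section

open scoped Manifold ContDiff Topology TensorProduct
open CategoryTheory AlgebraicGeometry Function Set Filter Metric Complex Module
open Literature.AlgebraicTopology.SingularHomology
open Literature.Geometry.Kaehler Literature.Geometry.Manifold Literature.NumberTheory.Transcendental
open Literature.AlgebraicGeometry.Motives

namespace Literature.AlgebraicGeometry.HodgeTheory

-- The identification `TangentSpace I x = E` is an abuse of definitional equality; as in the tree's
-- form files we let `isDefEq` unfold it.
set_option backward.isDefEq.respectTransparency false

/-! ### The frame of `Fⁿ 𝓗ⁿ` from relative closed forms, in the algebraic chart at `t₁` -/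

section Frame

variable {𝒳 S : SchemeOver ℂ} (f : 𝒳 ⟶ S)

set_option maxHeartbeats 400000 in
/-- **A holomorphic frame of `Fⁿ 𝓗ⁿ` from relative closed forms on the total space, IN THE ALGEBRAIC
CHART AT `t₁`** (the statement of `exists_weightFrames_of_relativeForms` with its chart `ψ` PINNED: `ψ` is
the algebraic chart `extChartAt 𝓘(ℂ, ℂᵐ) t₁` transferred to the `univ`-subtype — values, source and
inverse recorded — so that consumers can read other holomorphic functions of the base, e.g. regular
functions, in the SAME chart; the proof is prover-Bx's, verbatim, the three identities holding by `rfl`)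
(Griffiths 1968
Thm. 1.1 ∕ Voisin I Thm. 10.3 for `p = n`, assembled from the bricks of the programme — see the module
docstring). Setting: `f : 𝒳 ⟶ S` a smooth projective family of relative dimension `n ≥ 1` over `S`
smooth of relative dimension `m` and separated, `𝒳(ℂ)` second countable, cohomologically locally
trivial over `S(ℂ)`, Hodge-symmetric fibre models `A t` (they only serve to name the Hodge filtration,
which is model-independent). Local data at `t₁`: an open `O ∋ t₁` and finitely many smooth `n`-forms
`Ξ j` on `𝒳(ℂ)` (algebraic charts) satisfying over `O` the kernel-vertical `(1,0)`-condition of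
`PeriodsOfRelativeFormsHolomorphic` and the FIBREWISE FRAME property: on every fibre `X_t`, `t ∈ O`, the
restrictions `(fiberι)^*Ξ j` are closed and their classes (read through the algebraic-chart model and de
Rham's integration comparison) are linearly independent and span `Fⁿ` of `(A t).hodgeStructure … n`.
Conclusion: VERBATIM the binder `hF2` of `hodgeLociDichotomy_of_weightTwoFrames` at `(s, t₁, N, T₁)`
(with `d := m`, degree `n`): a path-connected open `W₀ ∋ t₁` inside `N`, a chart `ψ` with
`W₀ ⊆ ψ.source`, and `r₂ = |J|` vectors `w₂ i t ∈ ℂ ⊗ Hⁿ(X_s; ℚ)` forming, along every continuation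
`T` of `T₁` inside `W₀`, a linearly independent frame of `Fⁿ(T^*H_t)`, with holomorphic coordinates on
`ψ(W₀)`. [cite: Griffiths1968PeriodsII, Thm. 1.1] [cite: VoisinHodgeI2002, §10.2.1 Thm. 10.3 and §9.2.1]
[cite: Griffiths1969, §8] -/
theorem exists_weightFrames_of_relativeForms_chartAt {n m : ℕ} (hn : 1 ≤ n)
    (hf : IsSmoothProjectiveFamily f n) [AlgebraicGeometry.SmoothOfRelativeDimension m S.hom]
    [AlgebraicGeometry.IsSeparated S.hom] [SecondCountableTopology (ComplexPoints 𝒳)]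
    (hU : IsCohomologicallyLocallyTrivialOn f (Set.univ : Set (ComplexPoints S)))
    (A : ∀ t : ComplexPoints S, HodgeModel n (fiberOver f t)) (hA : ∀ t, (A t).IsHodgeSymmetric)
    (s t₁ : (Set.univ : Set (ComplexPoints S))) (N : Set (Set.univ : Set (ComplexPoints S)))
    (hN : N ∈ 𝓝 t₁)
    (T₁ : singularCohomology ℚ ℚ (ComplexPoints (fiberOver f s.1)) n ≃ₗ[ℚ]
      singularCohomology ℚ ℚ (ComplexPoints (fiberOver f t₁.1)) n)
    {O : Set (ComplexPoints S)} (hO : IsOpen O) (ht₁O : t₁.1 ∈ O) {J : Type} [Fintype J] :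
    letI := Motives.smoothOfRelativeDimension_total (m := m) f hf
    letI : AlgebraicGeometry.Smooth 𝒳.hom := AlgebraicGeometry.SmoothOfRelativeDimension.smooth (n + m) _
    letI : AlgebraicGeometry.LocallyOfFiniteType 𝒳.hom := inferInstance
    letI : AlgebraicGeometry.Smooth S.hom := AlgebraicGeometry.SmoothOfRelativeDimension.smooth m _
    letI : AlgebraicGeometry.LocallyOfFiniteType S.hom := inferInstance
    letI := chartedSpaceOfCharts (ComplexPoints.algebraicChart 𝒳 (n + m))
      (ComplexPoints.mem_algebraicChart_source 𝒳 (n + m))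
    letI := chartedSpaceOfCharts (ComplexPoints.algebraicChart S m)
      (ComplexPoints.mem_algebraicChart_source S m)
    ∀ (Ξ : J → MForm 𝓘(ℝ, Fin (n + m) → ℂ) (ComplexPoints 𝒳) ℂ n),
      (∀ j, IsSmoothForm (Ξ j)) →
      (∀ j (y : ComplexPoints 𝒳), AlgPoints.map f y ∈ O →
        ∀ (v : Fin (n + m) → ℂ) (w : Fin n → Fin (n + m) → ℂ),
        (∀ i, mfderiv 𝓘(ℝ, Fin (n + m) → ℂ) 𝓘(ℝ, Fin m → ℂ)
          (AlgPoints.map f : ComplexPoints 𝒳 → ComplexPoints S) y (w i) = 0) →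
        (show (Fin (n + m) → ℂ) [⋀^Fin (n + 1)]→L[ℝ] ℂ from mextDeriv (Ξ j) y) (Fin.cons (I • v) w) =
          I * (show (Fin (n + m) → ℂ) [⋀^Fin (n + 1)]→L[ℝ] ℂ from mextDeriv (Ξ j) y)
            (Fin.cons v w)) →
      (∀ t ∈ O,
        ∃ (x : J → ℂ ⊗[ℚ] singularCohomology ℚ ℚ (ComplexPoints (fiberOver f t)) n)
          (β : J → cclosedSmoothForms (algebraicModel (hf.isSmoothProjective t)).model
            (algebraicModel (hf.isSmoothProjective t)).carrier n),
          (∀ j, (β j : MForm 𝓘(ℝ, (algebraicModel (hf.isSmoothProjective t)).model)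
              (algebraicModel (hf.isSmoothProjective t)).carrier ℂ n) =
            (Ξ j).pullback 𝓘(ℝ, (algebraicModel (hf.isSmoothProjective t)).model)
              (fun a : (algebraicModel (hf.isSmoothProjective t)).carrier ↦
                (AlgPoints.map (fiberι f t) a : ComplexPoints 𝒳))) ∧
          (∀ j, (algebraicModel (hf.isSmoothProjective t)).complexification (hf.isSmoothProjective t) n
              (x j) = complexifyFun (integrationDeRhamIsoFamily
                (algebraicModel (hf.isSmoothProjective t)).model) n
              (complexDeRhamCohomology.mk _ _ n (β j))) ∧
          LinearIndependent ℂ x ∧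
          ((A t).hodgeStructure (hf.isSmoothProjective t) (hA t) n).F n =
            Submodule.span ℂ (Set.range x)) →
      ∃ W₀ : Set (Set.univ : Set (ComplexPoints S)), IsOpen W₀ ∧ t₁ ∈ W₀ ∧ W₀ ⊆ N ∧
        IsPathConnected W₀ ∧
      ∃ ψ : OpenPartialHomeomorph (Set.univ : Set (ComplexPoints S)) (Fin m → ℂ),
        ((∀ t, (ψ t : Fin m → ℂ) = extChartAt 𝓘(ℂ, Fin m → ℂ) t₁.1 t.1) ∧
          (∀ t, t ∈ ψ.source ↔ t.1 ∈ (extChartAt 𝓘(ℂ, Fin m → ℂ) t₁.1).source) ∧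
          (∀ z, ((ψ.symm z : (Set.univ : Set (ComplexPoints S))) : ComplexPoints S) =
            (extChartAt 𝓘(ℂ, Fin m → ℂ) t₁.1).symm z)) ∧
        W₀ ⊆ ψ.source ∧
      ∃ (r₂ : ℕ) (w₂ : Fin r₂ → Set.Elem (Set.univ : Set (ComplexPoints S)) →
        ℂ ⊗[ℚ] singularCohomology ℚ ℚ (ComplexPoints (fiberOver f s.1)) n),
        (∀ t ∈ W₀, ∀ (ε' : Path t₁ t), (∀ r', ε' r' ∈ W₀) →
          ∀ (T : singularCohomology ℚ ℚ (ComplexPoints (fiberOver f s.1)) n ≃ₗ[ℚ]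
            singularCohomology ℚ ℚ (ComplexPoints (fiberOver f t.1)) n),
          (∀ v, ofRatClass _ n (T v) = transportFun f n hU ⟦ε'⟧ (ofRatClass _ n (T₁ v))) →
          LinearIndependent ℂ (fun i ↦ w₂ i t) ∧
            (((A t.1).hodgeStructure (hf.isSmoothProjective t.1) (hA t.1) n).comapEquiv T).F n =
              Submodule.span ℂ (Set.range fun i ↦ w₂ i t)) ∧
        (∀ (i : Fin r₂)
          (φ : Module.Dual ℂ (ℂ ⊗[ℚ] singularCohomology ℚ ℚ (ComplexPoints (fiberOver f s.1)) n)),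
          AnalyticOnNhd ℂ (fun z ↦ φ (w₂ i (ψ.symm z))) (ψ '' W₀)) := by
  -- ### instances
  haveI := Motives.smoothOfRelativeDimension_total (m := m) f hf
  haveI : AlgebraicGeometry.Smooth 𝒳.hom := AlgebraicGeometry.SmoothOfRelativeDimension.smooth (n + m) _
  haveI : AlgebraicGeometry.LocallyOfFiniteType 𝒳.hom := inferInstance
  haveI : AlgebraicGeometry.Smooth S.hom := AlgebraicGeometry.SmoothOfRelativeDimension.smooth m _
  haveI : AlgebraicGeometry.LocallyOfFiniteType S.hom := inferInstance
  letI csT := chartedSpaceOfCharts (ComplexPoints.algebraicChart 𝒳 (n + m))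
    (ComplexPoints.mem_algebraicChart_source 𝒳 (n + m))
  letI csB := chartedSpaceOfCharts (ComplexPoints.algebraicChart S m)
    (ComplexPoints.mem_algebraicChart_source S m)
  intro Ξ hΞs hdΞ hframe
  classical
  have hX : ∀ t : ComplexPoints S, IsSmoothProjective n (fiberOver f t) := fun t ↦ hf.isSmoothProjective t
  haveI : IsManifold 𝓘(ℂ, Fin (n + m) → ℂ) ω (ComplexPoints 𝒳) := isManifold_algebraicChart 𝒳 (n + m)
  haveI : IsManifold 𝓘(ℂ, Fin m → ℂ) ω (ComplexPoints S) := isManifold_algebraicChart S m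
  haveI : IsManifold 𝓘(ℝ, Fin (n + m) → ℂ) ∞ (ComplexPoints 𝒳) := isManifold_real_of_isManifold_complex
  haveI : IsManifold 𝓘(ℝ, Fin m → ℂ) ∞ (ComplexPoints S) := isManifold_real_of_isManifold_complex
  haveI : AlgebraicGeometry.IsSeparated 𝒳.hom := by
    haveI := hf.isProper
    have h : AlgebraicGeometry.IsSeparated (f.left ≫ S.hom) := inferInstance
    rwa [Over.w f] at h
  haveI : T2Space (ComplexPoints 𝒳) := ComplexPoints.t2Space_of_isSeparated 𝒳
  haveI : T2Space (ComplexPoints S) := ComplexPoints.t2Space_of_isSeparated S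
  -- the fibres, with the algebraic charts of `algebraicModel`
  letI csF : ∀ b : ComplexPoints S, ChartedSpace (Fin n → ℂ) (ComplexPoints (fiberOver f b)) :=
    fun b ↦ (algebraicModel (hX b)).chartedSpace
  haveI : ∀ b, IsManifold 𝓘(ℂ, Fin n → ℂ) ω (ComplexPoints (fiberOver f b)) :=
    fun b ↦ (algebraicModel (hX b)).isManifold
  haveI : ∀ b, IsManifold 𝓘(ℝ, Fin n → ℂ) ∞ (ComplexPoints (fiberOver f b)) :=
    fun b ↦ (algebraicModel (hX b)).isManifold_real
  haveI : ∀ b, T2Space (ComplexPoints (fiberOver f b)) :=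
    fun b ↦ ComplexPoints.t2Space_of_isSmoothProjective (hX b)
  haveI : ∀ b, CompactSpace (ComplexPoints (fiberOver f b)) :=
    fun b ↦ ComplexPoints.compactSpace_of_isSmoothProjective (hX b)
  haveI : ∀ b, SigmaCompactSpace (ComplexPoints (fiberOver f b)) :=
    fun b ↦ (algebraicModel (hX b)).sigmaCompactSpace
  -- `f(ℂ)` is a proper holomorphic submersion; the fibre embeddings
  obtain ⟨hπ, hιall⟩ := isProperHolomorphicSubmersion_and_isFibreEmbedding_of_isSmoothProjectiveFamily
    (m := m) f hf
  have hdim : Module.finrank ℂ (Fin n → ℂ) + Module.finrank ℂ (Fin m → ℂ) =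
      Module.finrank ℂ (Fin (n + m) → ℂ) := finrank_fibre_add_base n m
  -- ### the model `B` of the base fibre `X_{t₁}`, the orientation
  obtain ⟨k, rfl⟩ : ∃ k, n = k + 1 := ⟨n - 1, by omega⟩
  set B : HodgeModel (k + 1) (fiberOver f t₁.1) := algebraicModel (hX t₁.1) with hBdef
  haveI hfact : Fact (Module.finrank ℝ (Fin (k + 1) → ℂ) = (k + 1) + (k + 1)) :=
    ⟨by rw [finrank_real_of_complex, Module.finrank_fin_fun]; ring⟩
  obtain ⟨o₀, ho₀, hI⟩ := exists_orientation_cintegral_ne_zero_algebraicChart (hX t₁.1)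
    (m := (k + 1) + (k + 1)) (by ring)
  -- ### (A) the fibrewise frame data and the period-holomorphy brick F-C, per form
  choose x β hβ hx hli hspan using hframe
  have hΞc : ∀ j, ∀ b ∈ O, IsClosedForm ((Ξ j).pullback 𝓘(ℝ, Fin (k + 1) → ℂ)
      (AlgPoints.map (fiberι f b) : ComplexPoints (fiberOver f b) → ComplexPoints 𝒳)) := by
    intro j b hb
    have hmem := (β b hb j).2
    rw [mem_cclosedSmoothForms_iff] at hmem
    have heq : (Ξ j).pullback 𝓘(ℝ, Fin (k + 1) → ℂ)
        (AlgPoints.map (fiberι f b) : ComplexPoints (fiberOver f b) → ComplexPoints 𝒳) =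
        (β b hb j : MForm 𝓘(ℝ, (algebraicModel (hX b)).model) (algebraicModel (hX b)).carrier ℂ (k + 1)) :=
      (hβ b hb j).symm
    rw [heq]
    exact hmem.2
  have hFC := fun j ↦ IsProperHolomorphicSubmersion.exists_chartBall_trivialisation_periods_analytic hπ
    hO ht₁O (X := fun b ↦ ComplexPoints (fiberOver f b))
    (ι := fun b ↦ (AlgPoints.map (fiberι f b) : ComplexPoints (fiberOver f b) → ComplexPoints 𝒳))
    (fun b _ ↦ hιall b) hdim (o := fun _ : ComplexPoints (fiberOver f t₁.1) ↦ o₀) ho₀ (k := k) (l := k + 1)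
    (rfl : (k + 1) + (k + 1) = (k + 1) + (k + 1)) (hΞs j) (hΞc j) (hdΞ j)
  choose r Φ hr hbt hbO hΦ0 hπΦ hΦsm himm hdiff h5 h6 using hFC
  -- ### (B) the chart of the base at `t₁` and a small ball
  set c := extChartAt 𝓘(ℂ, Fin m → ℂ) t₁.1 with hc
  have hct₁ : t₁.1 ∈ c.source := mem_extChartAt_source (I := 𝓘(ℂ, Fin m → ℂ)) t₁.1
  -- the point of the univ-subtype under `z`
  have hsymmN : ∀ᶠ z in 𝓝 (c t₁.1), (⟨c.symm z, Set.mem_univ _⟩ : (Set.univ : Set (ComplexPoints S))) ∈ N := by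
    have hcs : ContinuousAt c.symm (c t₁.1) := continuousAt_extChartAt_symm t₁.1
    have hcont : ContinuousAt (fun z ↦ (⟨c.symm z, Set.mem_univ _⟩ : (Set.univ : Set (ComplexPoints S))))
        (c t₁.1) := (Homeomorph.Set.univ (ComplexPoints S)).symm.continuous.continuousAt.comp hcs
    have hval : (⟨c.symm (c t₁.1), Set.mem_univ _⟩ : (Set.univ : Set (ComplexPoints S))) = t₁ := by
      apply Subtype.ext
      exact extChartAt_to_inv (I := 𝓘(ℂ, Fin m → ℂ)) t₁.1
    have hN' : N ∈ 𝓝 ((⟨c.symm (c t₁.1), Set.mem_univ _⟩ : (Set.univ : Set (ComplexPoints S)))) := by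
      rw [hval]; exact hN
    exact hcont.preimage_mem_nhds hN'
  have hsymmO : ∀ᶠ z in 𝓝 (c t₁.1), c.symm z ∈ O := by
    have hcs : ContinuousAt c.symm (c t₁.1) := continuousAt_extChartAt_symm t₁.1
    refine hcs.preimage_mem_nhds ?_
    rw [extChartAt_to_inv (I := 𝓘(ℂ, Fin m → ℂ)) t₁.1]
    exact hO.mem_nhds ht₁O
  have hG : ((c.target ∩ ⋂ j, ball (c t₁.1) (r j)) ∩
      {z | (⟨c.symm z, Set.mem_univ _⟩ : (Set.univ : Set (ComplexPoints S))) ∈ N}) ∩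
      {z | c.symm z ∈ O} ∈ 𝓝 (c t₁.1) := by
    refine Filter.inter_mem (Filter.inter_mem (Filter.inter_mem
      (extChartAt_target_mem_nhds (I := 𝓘(ℂ, Fin m → ℂ)) t₁.1)
      ((Filter.iInter_mem).2 fun j ↦ ball_mem_nhds _ (hr j))) hsymmN) hsymmO
  obtain ⟨ρ, hρ, hρG⟩ := Metric.mem_nhds_iff.1 hG
  have hDT : ball (c t₁.1) ρ ⊆ c.target := fun z hz ↦ (hρG hz).1.1.1
  have hDr : ∀ j, ball (c t₁.1) ρ ⊆ ball (c t₁.1) (r j) := fun j z hz ↦ Set.mem_iInter.1 (hρG hz).1.1.2 j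
  have hDN : ∀ z ∈ ball (c t₁.1) ρ,
      (⟨c.symm z, Set.mem_univ _⟩ : (Set.univ : Set (ComplexPoints S))) ∈ N := fun z hz ↦ (hρG hz).1.2
  have hDO : ∀ z ∈ ball (c t₁.1) ρ, c.symm z ∈ O := fun z hz ↦ (hρG hz).2
  -- ### (C) the chart `ψ` of the univ-subtype and the neighbourhood `W₀`
  let ψ : OpenPartialHomeomorph (Set.univ : Set (ComplexPoints S)) (Fin m → ℂ) :=
    (Homeomorph.Set.univ (ComplexPoints S)).transOpenPartialHomeomorph (chartAt (Fin m → ℂ) t₁.1)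
  have hψapply : ∀ t, ψ t = c t.1 := fun t ↦ rfl
  have hψsymm : ∀ z, (ψ.symm z : ComplexPoints S) = c.symm z := fun z ↦ rfl
  have hψsource : ∀ t, t ∈ ψ.source ↔ t.1 ∈ c.source := fun t ↦ by
    rw [hc, extChartAt_source]; rfl
  have hψtarget : ∀ z, z ∈ c.target → z ∈ ψ.target := fun z hz ↦ by
    have h1 : c.symm z ∈ c.source := c.map_target hz
    have h2 : c (c.symm z) = z := c.right_inv hz
    rw [hc, extChartAt_source] at h1
    have h3 := (chartAt (Fin m → ℂ) t₁.1).map_source h1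
    change chartAt (Fin m → ℂ) t₁.1 (c.symm z) ∈ _ at h3
    have h4 : chartAt (Fin m → ℂ) t₁.1 (c.symm z) = c (c.symm z) := rfl
    rw [h4, h2] at h3
    exact h3
  set W₀ : Set (Set.univ : Set (ComplexPoints S)) := ψ.source ∩ ψ ⁻¹' ball (c t₁.1) ρ with hW₀
  have hW₀o : IsOpen W₀ := ψ.isOpen_inter_preimage isOpen_ball
  have ht₁W₀ : t₁ ∈ W₀ := ⟨(hψsource t₁).2 hct₁, by
    change ψ t₁ ∈ ball (c t₁.1) ρ; rw [hψapply]; exact mem_ball_self hρ⟩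
  have hW₀src : ∀ t ∈ W₀, t.1 ∈ c.source := fun t ht ↦ (hψsource t).1 ht.1
  have hW₀ball : ∀ t ∈ W₀, c t.1 ∈ ball (c t₁.1) ρ := fun t ht ↦ ht.2
  have hW₀N : W₀ ⊆ N := fun t ht ↦ by
    have h := hDN _ (hW₀ball t ht)
    have hval : (⟨c.symm (c t.1), Set.mem_univ _⟩ : (Set.univ : Set (ComplexPoints S))) = t :=
      Subtype.ext (c.left_inv (hW₀src t ht))
    rwa [hval] at h
  have hW₀img : W₀ = ψ.symm '' ball (c t₁.1) ρ := by
    rw [ψ.symm_image_eq_source_inter_preimage (fun z hz ↦ hψtarget z (hDT hz))]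
  have hW₀pc : IsPathConnected W₀ := by
    rw [hW₀img]
    exact ((convex_ball (c t₁.1) ρ).isPathConnected ⟨c t₁.1, mem_ball_self hρ⟩).image'
      (ψ.continuousOn_symm.mono fun z hz ↦ hψtarget z (hDT hz))
  have hψW₀ : ψ '' W₀ = ball (c t₁.1) ρ := by
    apply Set.Subset.antisymm
    · rintro _ ⟨t, ht, rfl⟩; exact ht.2
    · intro z hz
      refine ⟨ψ.symm z, ?_, ψ.right_inv (hψtarget z (hDT hz))⟩
      rw [hW₀img]; exact Set.mem_image_of_mem _ hz
  -- membership consequences for `t ∈ W₀`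
  have hWO : ∀ t ∈ W₀, t.1 ∈ O := fun t ht ↦ by
    have h := hDO (c t.1) (hW₀ball t ht)
    rwa [c.left_inv (hW₀src t ht)] at h
  -- ### (D) the fibre maps `X_{t₁}(ℂ) → X_t(ℂ)` of the trivialisations, as diffeomorphisms
  have hιemb : ∀ b, Manifold.IsSmoothEmbedding 𝓘(ℝ, Fin (k + 1) → ℂ) 𝓘(ℝ, Fin (k + 1 + m) → ℂ) ∞
      (AlgPoints.map (fiberι f b) : ComplexPoints (fiberOver f b) → ComplexPoints 𝒳) := fun b ↦
    Literature.Topology.FourManifolds.isSmoothEmbedding_of_injective_of_injective_mfderiv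
      (hιall b).contMDiff_real (by simp) (hιall b).isClosedEmbedding.injective
      (hιall b).injective_mfderiv_real
  have hdiffeo : ∀ j, ∀ t ∈ W₀, ∃ e : ComplexPoints (fiberOver f t₁.1) ≃ₘ^∞⟮𝓘(ℝ, Fin (k + 1) → ℂ),
      𝓘(ℝ, Fin (k + 1) → ℂ)⟯ ComplexPoints (fiberOver f t.1),
      ∀ y, AlgPoints.map (fiberι f t.1) (e y) = Φ j (c t.1) y := by
    intro j t ht
    obtain ⟨hsm, hinj, himm', hrange⟩ := himm j (c t.1) (hDr j (hW₀ball t ht))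
    have hemb := Literature.Topology.FourManifolds.isSmoothEmbedding_of_injective_of_injective_mfderiv
      hsm (by simp) hinj himm'
    have hrange' : Set.range (Φ j (c t.1)) =
        Set.range (AlgPoints.map (fiberι f t.1) : ComplexPoints (fiberOver f t.1) → ComplexPoints 𝒳) := by
      rw [hrange, (hιall t.1).range_eq, c.left_inv (hW₀src t ht)]
    exact exists_diffeomorph_comp_eq_of_range_eq hemb (hιemb t.1) hrange'
  choose e he using hdiffeo
  haveI hne : ∀ b : ComplexPoints S, Nonempty (ComplexPoints (fiberOver f b)) :=
    fun b ↦ (algebraicModel (hX b)).nonempty_carrier (hX b)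
  let Φ' : J → ∀ t : (Set.univ : Set (ComplexPoints S)),
      C(ComplexPoints (fiberOver f t₁.1), ComplexPoints (fiberOver f t.1)) := fun j t ↦
    if ht : t ∈ W₀ then ((e j t ht).toHomeomorph : C(ComplexPoints (fiberOver f t₁.1),
      ComplexPoints (fiberOver f t.1))) else ContinuousMap.const _ (Classical.arbitrary _)
  have hΦ'W : ∀ j t (ht : t ∈ W₀), Φ' j t = ((e j t ht).toHomeomorph :
      C(ComplexPoints (fiberOver f t₁.1), ComplexPoints (fiberOver f t.1))) := fun j t ht ↦ dif_pos ht
  have hΦ'apply : ∀ j t (ht : t ∈ W₀) y, Φ' j t y = e j t ht y := fun j t ht y ↦ by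
    rw [hΦ'W j t ht]; rfl
  have hΦ'ι : ∀ j t (ht : t ∈ W₀) y, AlgPoints.map (fiberι f t.1) (Φ' j t y) = Φ j (c t.1) y :=
    fun j t ht y ↦ by rw [hΦ'apply j t ht]; exact he j t ht y
  have hΦ'₁ : ∀ j y, Φ' j t₁ y = y := fun j y ↦ by
    apply (hιall t₁.1).isClosedEmbedding.injective
    rw [hΦ'ι j t₁ ht₁W₀, hΦ0 j y]
  have hbij : ∀ j, ∀ t ∈ W₀, Function.Bijective (singularCohomology.map ℂ ℂ (Φ' j t) (k + 1)) := by
    intro j t ht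
    rw [hΦ'W j t ht]
    exact (singularCohomology.mapIso ℂ ℂ (e j t ht).toHomeomorph (k + 1)).toLinearEquiv.bijective
  have hcont : ∀ j, ContinuousOn (fun yt : ComplexPoints (fiberOver f t₁.1) × (Set.univ : Set (ComplexPoints S)) ↦
      AlgPoints.map (fiberι f yt.2.1) (Φ' j yt.2 yt.1)) (Set.univ ×ˢ W₀) := by
    intro j
    have hpair : ContinuousOn (fun yt : ComplexPoints (fiberOver f t₁.1) × (Set.univ : Set (ComplexPoints S)) ↦
        (c yt.2.1, yt.1)) (Set.univ ×ˢ W₀) := by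
      refine ContinuousOn.prodMk ?_ continuous_fst.continuousOn
      exact (continuousOn_extChartAt (I := 𝓘(ℂ, Fin m → ℂ)) t₁.1).comp
        (continuous_subtype_val.comp continuous_snd).continuousOn fun yt hyt ↦ hW₀src _ hyt.2
    have h1 : ContinuousOn (fun yt : ComplexPoints (fiberOver f t₁.1) × (Set.univ : Set (ComplexPoints S)) ↦
        uncurry (Φ j) (c yt.2.1, yt.1)) (Set.univ ×ˢ W₀) :=
      (hΦsm j).continuousOn.comp hpair fun yt hyt ↦ ⟨hDr j (hW₀ball _ hyt.2), Set.mem_univ _⟩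
    refine h1.congr fun yt hyt ↦ ?_
    exact hΦ'ι j yt.2 hyt.2 yt.1
  -- ### (E) the frame vectors, read on the base fibre `X_{t₁}` through the trivialisations
  have hαmem : ∀ j, ∀ p ∈ ball (c t₁.1) (r j), (Ξ j).pullback 𝓘(ℝ, Fin (k + 1) → ℂ) (Φ j p) ∈
      cclosedSmoothForms (Fin (k + 1) → ℂ) (ComplexPoints (fiberOver f t₁.1)) (k + 1) := fun j p hp ↦
    (mem_cclosedSmoothForms_iff _).2 ⟨(h5 j p hp).1, (h5 j p hp).2⟩
  let yv : ∀ (j : J) (p : Fin m → ℂ), p ∈ ball (c t₁.1) (r j) →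
      ℂ ⊗[ℚ] singularCohomology ℚ ℚ (ComplexPoints (fiberOver f t₁.1)) (k + 1) := fun j p hp ↦
    (B.complexification (hX t₁.1) (k + 1)).symm
      (complexifyFun (integrationDeRhamIsoFamily (Fin (k + 1) → ℂ)) (k + 1)
        (complexDeRhamCohomology.mk (Fin (k + 1) → ℂ) (ComplexPoints (fiberOver f t₁.1)) (k + 1)
          ⟨_, hαmem j p hp⟩) : singularCohomology ℂ ℂ (ComplexPoints (fiberOver f t₁.1)) (k + 1))
  have hyv : ∀ j p hp, B.complexification (hX t₁.1) (k + 1) (yv j p hp) =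
      (complexifyFun (integrationDeRhamIsoFamily (Fin (k + 1) → ℂ)) (k + 1)
        (complexDeRhamCohomology.mk (Fin (k + 1) → ℂ) (ComplexPoints (fiberOver f t₁.1)) (k + 1)
          ⟨_, hαmem j p hp⟩) : singularCohomology ℂ ℂ (ComplexPoints (fiberOver f t₁.1)) (k + 1)) :=
    fun j p hp ↦ (B.complexification (hX t₁.1) (k + 1)).apply_symm_apply _
  -- `Θ_B = Θ'` for the algebraic-chart model (structure map `id`)
  have hBpull : ∀ z : singularCohomology ℂ ℂ (ComplexPoints (fiberOver f t₁.1)) (k + 1),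
      B.pullback (k + 1) z = z := fun z ↦ by
    have hid : (⟨B.toComplexPoints, B.isAnalytification.isHomeomorph.continuous⟩ :
        C(B.carrier, ComplexPoints (fiberOver f t₁.1))) = ContinuousMap.id _ := ContinuousMap.ext fun _ ↦ rfl
    change singularCohomology.map ℂ ℂ ⟨B.toComplexPoints, B.isAnalytification.isHomeomorph.continuous⟩
      (k + 1) z = z
    rw [hid, singularCohomology.map_id]
    rfl
  let w : J → Set.Elem (Set.univ : Set (ComplexPoints S)) →
      ℂ ⊗[ℚ] singularCohomology ℚ ℚ (ComplexPoints (fiberOver f s.1)) (k + 1) := fun j t ↦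
    if ht : t ∈ W₀ then (T₁.baseChange ℚ ℂ _ _).symm (yv j (c t.1) (hDr j (hW₀ball t ht))) else 0
  have hwW : ∀ j t (ht : t ∈ W₀),
      w j t = (T₁.baseChange ℚ ℂ _ _).symm (yv j (c t.1) (hDr j (hW₀ball t ht))) := fun j t ht ↦ dif_pos ht
  -- ### (F) along every continuation `T` of `T₁` inside `W₀`, `w j t = T_ℂ⁻¹ (x j t)`: a frame of `Fⁿ(T^*H_t)`
  have hframeT : ∀ t (ht : t ∈ W₀) (ε' : Path t₁ t), (∀ r', ε' r' ∈ W₀) →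
      ∀ (T : singularCohomology ℚ ℚ (ComplexPoints (fiberOver f s.1)) (k + 1) ≃ₗ[ℚ]
        singularCohomology ℚ ℚ (ComplexPoints (fiberOver f t.1)) (k + 1)),
      (∀ v, ofRatClass _ (k + 1) (T v) = transportFun f (k + 1) hU ⟦ε'⟧ (ofRatClass _ (k + 1) (T₁ v))) →
      LinearIndependent ℂ (fun j ↦ w j t) ∧
        (((A t.1).hodgeStructure (hX t.1) (hA t.1) (k + 1)).comapEquiv T).F ((k + 1 : ℕ) : ℤ) =
          Submodule.span ℂ (Set.range fun j ↦ w j t) := by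
    intro t ht ε' hε' T hT
    have htO := hWO t ht
    have hwj : ∀ j, w j t = (T.baseChange ℚ ℂ _ _).symm (x t.1 htO j) := by
      intro j
      have hp := hDr j (hW₀ball t ht)
      rw [hwW j t ht]
      refine (baseChange_symm_eq_of_continuation f (k + 1) hU (Φ' j) (hcont j) (hbij j) ht₁W₀ T₁ ε'
        hε' T hT ?_).symm
      -- the two readings on `X_{t₁}(ℂ)`
      have hιmd : MDifferentiable 𝓘(ℝ, Fin (k + 1) → ℂ) 𝓘(ℝ, Fin (k + 1 + m) → ℂ)
          (AlgPoints.map (fiberι f t.1) : ComplexPoints (fiberOver f t.1) → ComplexPoints 𝒳) :=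
        (hιall t.1).contMDiff_real.mdifferentiable (by simp)
      have hemd : MDifferentiable 𝓘(ℝ, Fin (k + 1) → ℂ) 𝓘(ℝ, Fin (k + 1) → ℂ) (e j t ht) :=
        (e j t ht).contMDiff.mdifferentiable (by simp)
      -- LHS: cross-model naturality (F-D §5) along the diffeomorphism `e`
      have hL := map_ofRatClassBaseChange_eq_complexifyFun_pullback (hX t.1) (algebraicModel (hX t.1))
        (E := Fin (k + 1) → ℂ) (M₀ := ComplexPoints (fiberOver f t₁.1)) (g := e j t ht)
        (e j t ht).contMDiff (Φ' j t) (fun y ↦ hΦ'apply j t ht y) (k + 1) (x t.1 htO j) (β t.1 htO j)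
        (hx t.1 htO j)
      have hcomp : (fun a : (algebraicModel (hX t.1)).carrier ↦
          (AlgPoints.map (fiberι f t.1) a : ComplexPoints 𝒳)) ∘ (e j t ht) = Φ j (c t.1) :=
        funext fun y ↦ he j t ht y
      have hforms : ((β t.1 htO j : MForm 𝓘(ℝ, (algebraicModel (hX t.1)).model)
          (algebraicModel (hX t.1)).carrier ℂ (k + 1)).pullback 𝓘(ℝ, Fin (k + 1) → ℂ)
            (show ComplexPoints (fiberOver f t₁.1) → (algebraicModel (hX t.1)).carrier from e j t ht)) =
          (Ξ j).pullback 𝓘(ℝ, Fin (k + 1) → ℂ) (Φ j (c t.1)) := by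
        rw [hβ t.1 htO j, ← hcomp]
        exact (MForm.pullback_comp hιmd hemd (Ξ j)).symm
      rw [hL]
      -- RHS: `Φ' j t₁ = id`, `Θ_B = Θ'`
      have hid : Φ' j t₁ = ContinuousMap.id _ := ContinuousMap.ext (hΦ'₁ j)
      rw [hid, singularCohomology.map_id]
      change _ = ofRatClassBaseChange _ (k + 1) (yv j (c t.1) hp)
      rw [← hBpull (ofRatClassBaseChange _ (k + 1) (yv j (c t.1) hp)), ← B.complexification_apply (hX t₁.1),
        hyv j (c t.1) hp]
      congr 2
      exact Subtype.ext hforms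
    rw [HodgeStructure.comapEquiv_F]
    exact linearIndependent_and_comap_eq_span_of_frame T (hli t.1 htO) (hspan t.1 htO) hwj
  -- ### (G) the coordinates of the frame vectors are fixed finite combinations of holomorphic periods
  haveI : WedgeFacts 𝓘(ℝ, Fin (k + 1) → ℂ) (ComplexPoints (fiberOver f t₁.1)) ℂ := wedgeFacts_discharged _ _ ℂ
  letI : MeasurableSpace B.model := (inferInstance : MeasurableSpace (Fin (k + 1) → ℂ))
  haveI : BorelSpace B.model := (inferInstance : BorelSpace (Fin (k + 1) → ℂ))
  haveI : Fact (Module.finrank ℝ B.model = (k + 1) + (k + 1)) := hfact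
  obtain ⟨Nγ, γ, hγ⟩ := BettiUniverse.exists_dual_baseChange_symm_eq_sum_mul_cintegral_wedge (hX t₁.1) B
    (integrationDeRhamIsoFamily (Fin (k + 1) → ℂ)) integrationDeRhamIsoFamily_isMultiplicative
    (k := k + 1) (show (k + 1) + (k + 1) = 2 * (k + 1) by ring) (fun _ ↦ o₀) ho₀ hI T₁
  -- the test forms, read at the model type `ℂⁿ` / carrier `X_{t₁}(ℂ)` of the algebraic-chart model
  let γ' : Fin Nγ → MForm 𝓘(ℝ, Fin (k + 1) → ℂ) (ComplexPoints (fiberOver f t₁.1)) ℂ (k + 1) := fun l ↦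
    show MForm 𝓘(ℝ, Fin (k + 1) → ℂ) (ComplexPoints (fiberOver f t₁.1)) ℂ (k + 1) from (γ l).1
  have hγs : ∀ l, IsSmoothForm (γ' l) := fun l ↦ ((mem_cclosedSmoothForms_iff _).1 (γ l).2).1
  have hγc : ∀ l, IsClosedForm (γ' l) := fun l ↦ ((mem_cclosedSmoothForms_iff _).1 (γ l).2).2
  -- `hγ` read at the types `ℂⁿ` / `X_{t₁}(ℂ)` (the fields of `algebraicModel` are these by `rfl`),
  -- specialised to the frame vectors `yv`
  have hγ' : ∀ φ : Module.Dual ℂ (ℂ ⊗[ℚ] singularCohomology ℚ ℚ (ComplexPoints (fiberOver f s.1)) (k + 1)),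
      ∃ a : Fin Nγ → ℂ, ∀ (j : J) (p : Fin m → ℂ) (hp : p ∈ ball (c t₁.1) (r j)),
        φ ((T₁.baseChange ℚ ℂ _ _).symm (yv j p hp)) = ∑ l, a l *
          cintegral (fun _ : ComplexPoints (fiberOver f t₁.1) ↦ o₀)
            (((Ξ j).pullback 𝓘(ℝ, Fin (k + 1) → ℂ) (Φ j p)).wedge (γ' l)) := fun φ ↦ by
    obtain ⟨a, ha⟩ := hγ φ
    exact ⟨a, fun j p hp ↦ ha (yv j p hp) ⟨_, hαmem j p hp⟩ (hyv j p hp)⟩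
  -- the coordinate formula at the points of `W₀`
  have hcoord : ∀ (j : J) (φ : Module.Dual ℂ (ℂ ⊗[ℚ] singularCohomology ℚ ℚ (ComplexPoints (fiberOver f s.1)) (k + 1))),
      ∃ a : Fin Nγ → ℂ, ∀ t (ht : t ∈ W₀), φ (w j t) = ∑ l, (a l * (-1 : ℂ) ^ ((k + 1) * (k + 1))) *
        cintegral (fun _ : ComplexPoints (fiberOver f t₁.1) ↦ o₀)
          ((γ' l).wedge
            ((Ξ j).pullback 𝓘(ℝ, Fin (k + 1) → ℂ) (Φ j (c t.1)))) := by
    intro j φ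
    obtain ⟨a, ha⟩ := hγ' φ
    refine ⟨a, fun t ht ↦ ?_⟩
    have hp := hDr j (hW₀ball t ht)
    rw [hwW j t ht, ha j (c t.1) hp]
    refine Finset.sum_congr rfl fun l _ ↦ ?_
    rw [MForm.wedge_comm_smul_complex ((Ξ j).pullback 𝓘(ℝ, Fin (k + 1) → ℂ) (Φ j (c t.1))) (γ' l),
      HodgeRiemannDegreeOne.cintegral_smul' (o := fun _ : ComplexPoints (fiberOver f t₁.1) ↦ o₀)
        ho₀ _ (isSmoothForm_wedge (hγs l) (h5 j (c t.1) hp).1)]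
    ring
  -- ### conclusion
  let eJ := Fintype.equivFin J
  refine ⟨W₀, hW₀o, ht₁W₀, hW₀N, hW₀pc, ψ, ⟨hψapply, hψsource, hψsymm⟩, Set.inter_subset_left,
    Fintype.card J,
    fun i t ↦ w (eJ.symm i) t, ?_, ?_⟩
  · intro t ht ε' hε' T hT
    obtain ⟨hliT, hspanT⟩ := hframeT t ht ε' hε' T hT
    refine ⟨hliT.comp _ eJ.symm.injective, ?_⟩
    rw [hspanT, ← eJ.symm.surjective.range_comp (fun j ↦ w j t)]
    rfl
  · intro i φ
    set j := eJ.symm i with hj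
    obtain ⟨a, ha⟩ := hcoord j φ
    -- the periods are analytic on the chart ball (brick F-C)
    have hP : ∀ l, AnalyticOnNhd ℂ (fun p ↦ cintegral (fun _ : ComplexPoints (fiberOver f t₁.1) ↦ o₀)
        (((γ' l).wedge
          ((Ξ j).pullback 𝓘(ℝ, Fin (k + 1) → ℂ) (Φ j p))))) (ball (c t₁.1) (r j)) := fun l ↦ by
      simpa only [MForm.castDeg_rfl] using h6 j (γ' l) (hγs l) (hγc l)
    have hsum : AnalyticOnNhd ℂ (fun p ↦ ∑ l, (a l * (-1 : ℂ) ^ ((k + 1) * (k + 1))) *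
        cintegral (fun _ : ComplexPoints (fiberOver f t₁.1) ↦ o₀)
          ((γ' l).wedge
            ((Ξ j).pullback 𝓘(ℝ, Fin (k + 1) → ℂ) (Φ j p)))) (ball (c t₁.1) ρ) := by
      intro p hp
      exact Finset.analyticAt_fun_sum Finset.univ fun l _ ↦ analyticAt_const.mul (hP l p (hDr j hp))
    rw [hψW₀]
    refine hsum.congr isOpen_ball fun z hz ↦ ?_
    have hzW : ψ.symm z ∈ W₀ := by rw [hW₀img]; exact Set.mem_image_of_mem _ hz
    have hcz : c (ψ.symm z).1 = z := by rw [hψsymm]; exact c.right_inv (hDT hz)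
    change _ = φ (w j (ψ.symm z))
    rw [ha _ hzW, hcz]


end Frame

end Literature.AlgebraicGeometry.HodgeTheory

end
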